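import Mathlib

/-!
# Contraction of the shift for bounded positive semidefinite Hankel sequences

Let `a : ℕ → ℝ` be a bounded sequence whose Hankel quadratic forms
`c ↦ ∑ᵢ ∑ⱼ cᵢ cⱼ a (i + j)` are positive semidefinite. Then the once-shifted Hankel form is dominated
by the unshifted one: `|∑ᵢ ∑ⱼ cᵢ cⱼ a (i + j + 1)| ≤ ∑ᵢ ∑ⱼ cᵢ cⱼ a (i + j)` for every finite set of
indices and every real coefficient vector `c`. Writing `bₘ = ∑ᵢ ∑ⱼ cᵢ cⱼ a (i + j + m)`, this is the
classical Cauchy–Schwarz iteration `b₁² ≤ b₀ b₂`, `b₂² ≤ b₀ b₄`, …, `|b₁| ^ 2ᵏ ≤ b₀ ^ (2ᵏ - 1) b_{2ᵏ}`,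
combined with the boundedness of `m ↦ bₘ`: it is the step showing that bounded positive definite
sequences on `(ℕ, +)` are moment sequences of measures on `[-1, 1]`, and, applied to the two Hankel
forms `a (i + j)` and `a (i + j + 1)`, that bounded doubly Hankel-positive sequences are Hausdorff
moment sequences (Berg–Christensen–Ressel, Ch. 4, Prop. 4.9 and Ch. 6, §2).

* `hankel_shift_abs_le` — the contraction `|B(c, Sc)| ≤ B(c, c)`.

The helper namespace `HankelContraction` contains the Cauchy–Schwarz inequality for the Hankel form,
its specialisation `bₘ² ≤ b₀ b₂ₘ` to a coefficient vector and its `m`-fold shift, the bound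
`|bₘ| ≤ C (∑ᵢ |cᵢ|)²`, and the elementary real-variable lemma concluding `|b₁| ≤ b₀`.

## References

* C. Berg, J. P. R. Christensen, P. Ressel, *Harmonic Analysis on Semigroups. Theory of Positive
  Definite and Related Functions*, Graduate Texts in Mathematics 100, Springer (1984), Ch. 4,
  Prop. 4.9 (bounded positive definite sequences); Ch. 6, §2. [BergChristensenRessel1984]
-/

noncomputable section

open MeasureTheory Set Filter Topology
open scoped BigOperators

namespace Literature.MeasureTheory.Integral

namespace HankelContraction

/-! ## 1. Cauchy–Schwarz for a positive semidefinite Hankel form -/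

/-- Symmetry of the Hankel bilinear form `(u, v) ↦ ∑ᵢ ∑ⱼ uᵢ vⱼ a (i + j)`. [folklore] -/
theorem sum_sum_mul_swap (a : ℕ → ℝ) (T : Finset ℕ) (u v : ℕ → ℝ) :
    ∑ i ∈ T, ∑ j ∈ T, v i * u j * a (i + j) = ∑ i ∈ T, ∑ j ∈ T, u i * v j * a (i + j) := by
  rw [Finset.sum_comm]
  refine Finset.sum_congr rfl fun i _ => Finset.sum_congr rfl fun j _ => ?_
  rw [add_comm j i]
  ring

/-- **Cauchy–Schwarz** for the positive semidefinite Hankel form: `B(u, v)² ≤ B(u, u) B(v, v)`,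
from the discriminant of `t ↦ B(u + t v, u + t v) ≥ 0`. [folklore] -/
theorem sq_le_mul_of_hankel_psd (a : ℕ → ℝ)
    (hP0 : ∀ (s : Finset ℕ) (c : ℕ → ℝ), 0 ≤ ∑ i ∈ s, ∑ j ∈ s, c i * c j * a (i + j))
    (T : Finset ℕ) (u v : ℕ → ℝ) :
    (∑ i ∈ T, ∑ j ∈ T, u i * v j * a (i + j)) ^ 2 ≤
      (∑ i ∈ T, ∑ j ∈ T, u i * u j * a (i + j)) * ∑ i ∈ T, ∑ j ∈ T, v i * v j * a (i + j) := by
  have key : ∀ t : ℝ, 0 ≤ (∑ i ∈ T, ∑ j ∈ T, v i * v j * a (i + j)) * (t * t) +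
      2 * (∑ i ∈ T, ∑ j ∈ T, u i * v j * a (i + j)) * t +
        ∑ i ∈ T, ∑ j ∈ T, u i * u j * a (i + j) := by
    intro t
    have h := hP0 T (fun n => u n + t * v n)
    have e : ∀ i j : ℕ, (u i + t * v i) * (u j + t * v j) * a (i + j) = u i * u j * a (i + j) +
        (t * (u i * v j * a (i + j)) + (t * (v i * u j * a (i + j)) +
          t * t * (v i * v j * a (i + j)))) := by
      intro i j
      ring
    simp only [e, Finset.sum_add_distrib, ← Finset.mul_sum, sum_sum_mul_swap a T u v] at h
    linarith
  have hd := discrim_le_zero key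
  rw [discrim] at hd
  nlinarith [hd]

/-! ## 2. The Hankel form of a coefficient vector against its shift -/

/-- Summing the zero extension of `c` from `s` to `T ⊇ s`. [folklore] -/
theorem sum_ite_mem_mul (s T : Finset ℕ) (h : s ⊆ T) (c F : ℕ → ℝ) :
    ∑ i ∈ T, (if i ∈ s then c i else 0) * F i = ∑ i ∈ s, c i * F i := by
  simp only [ite_mul, zero_mul, Finset.sum_ite_mem, Finset.inter_eq_right.mpr h]

/-- Summing the `m`-fold shift of `c` (supported on `s + m`) over `T ⊇ s + m`. [folklore] -/
theorem sum_ite_mem_map_mul (s T : Finset ℕ) (m : ℕ) (h : s.map (addRightEmbedding m) ⊆ T)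
    (c G : ℕ → ℝ) :
    ∑ j ∈ T, (if j ∈ s.map (addRightEmbedding m) then c (j - m) else 0) * G j =
      ∑ j ∈ s, c j * G (j + m) := by
  simp only [ite_mul, zero_mul, Finset.sum_ite_mem, Finset.inter_eq_right.mpr h, Finset.sum_map,
    addRightEmbedding_apply, Nat.add_sub_cancel]

/-- **`bₘ² ≤ b₀ b₂ₘ`**: Cauchy–Schwarz applied to `c` (extended by zero) and its `m`-fold shift
`j ↦ c (j - m)` on the common support `s ∪ (s + m)`. [folklore] -/
theorem shift_sq_le (a : ℕ → ℝ)
    (hP0 : ∀ (s : Finset ℕ) (c : ℕ → ℝ), 0 ≤ ∑ i ∈ s, ∑ j ∈ s, c i * c j * a (i + j))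
    (s : Finset ℕ) (c : ℕ → ℝ) (m : ℕ) :
    (∑ i ∈ s, ∑ j ∈ s, c i * c j * a (i + j + m)) ^ 2 ≤
      (∑ i ∈ s, ∑ j ∈ s, c i * c j * a (i + j)) *
        ∑ i ∈ s, ∑ j ∈ s, c i * c j * a (i + j + 2 * m) := by
  obtain ⟨T, hs, hs'⟩ : ∃ T : Finset ℕ, s ⊆ T ∧ s.map (addRightEmbedding m) ⊆ T :=
    ⟨s ∪ s.map (addRightEmbedding m), Finset.subset_union_left, Finset.subset_union_right⟩
  have h := sq_le_mul_of_hankel_psd a hP0 T (fun n => if n ∈ s then c n else 0)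
    (fun n => if n ∈ s.map (addRightEmbedding m) then c (n - m) else 0)
  have e1 : ∑ i ∈ T, ∑ j ∈ T, (if i ∈ s then c i else 0) *
      (if j ∈ s.map (addRightEmbedding m) then c (j - m) else 0) * a (i + j) =
      ∑ i ∈ s, ∑ j ∈ s, c i * c j * a (i + j + m) := by
    simp only [mul_assoc, ← Finset.mul_sum]
    rw [sum_ite_mem_mul s T hs]
    simp only [sum_ite_mem_map_mul s T m hs', Finset.mul_sum, add_assoc]
  have e2 : ∑ i ∈ T, ∑ j ∈ T, (if i ∈ s then c i else 0) * (if j ∈ s then c j else 0) * a (i + j) =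
      ∑ i ∈ s, ∑ j ∈ s, c i * c j * a (i + j) := by
    simp only [mul_assoc, ← Finset.mul_sum]
    rw [sum_ite_mem_mul s T hs]
    simp only [sum_ite_mem_mul s T hs, Finset.mul_sum]
  have e3 : ∑ i ∈ T, ∑ j ∈ T, (if i ∈ s.map (addRightEmbedding m) then c (i - m) else 0) *
      (if j ∈ s.map (addRightEmbedding m) then c (j - m) else 0) * a (i + j) =
      ∑ i ∈ s, ∑ j ∈ s, c i * c j * a (i + j + 2 * m) := by
    simp only [mul_assoc, ← Finset.mul_sum]
    rw [sum_ite_mem_map_mul s T m hs']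
    simp only [sum_ite_mem_map_mul s T m hs', Finset.mul_sum]
    refine Finset.sum_congr rfl fun i _ => Finset.sum_congr rfl fun j _ => ?_
    rw [show i + m + (j + m) = i + j + 2 * m by omega]
  calc (∑ i ∈ s, ∑ j ∈ s, c i * c j * a (i + j + m)) ^ 2
      = (∑ i ∈ T, ∑ j ∈ T, (if i ∈ s then c i else 0) *
          (if j ∈ s.map (addRightEmbedding m) then c (j - m) else 0) * a (i + j)) ^ 2 := by rw [e1]
    _ ≤ _ := h
    _ = _ := by rw [e2, e3]

/-! ## 3. Boundedness of the shifted forms -/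

/-- `|bₘ| ≤ C (∑ᵢ |cᵢ|)²` when `|a n| ≤ C`. [folklore] -/
theorem abs_sum_sum_le (a : ℕ → ℝ) (C : ℝ) (hC : ∀ n, |a n| ≤ C) (s : Finset ℕ) (c : ℕ → ℝ)
    (m : ℕ) : |∑ i ∈ s, ∑ j ∈ s, c i * c j * a (i + j + m)| ≤ C * (∑ i ∈ s, |c i|) ^ 2 := by
  calc |∑ i ∈ s, ∑ j ∈ s, c i * c j * a (i + j + m)|
      ≤ ∑ i ∈ s, |∑ j ∈ s, c i * c j * a (i + j + m)| := Finset.abs_sum_le_sum_abs _ _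
    _ ≤ ∑ i ∈ s, ∑ j ∈ s, |c i| * |c j| * C := by
      refine Finset.sum_le_sum fun i _ => (Finset.abs_sum_le_sum_abs _ _).trans ?_
      refine Finset.sum_le_sum fun j _ => ?_
      rw [abs_mul, abs_mul]
      exact mul_le_mul_of_nonneg_left (hC _) (mul_nonneg (abs_nonneg _) (abs_nonneg _))
    _ = C * (∑ i ∈ s, |c i|) ^ 2 := by
      rw [sq, Finset.sum_mul_sum, Finset.mul_sum]
      refine Finset.sum_congr rfl fun i _ => ?_
      rw [Finset.mul_sum]
      exact Finset.sum_congr rfl fun j _ => by ring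

/-! ## 4. The real-variable conclusion -/

/-- If `b m ^ 2 ≤ b (2 m)` for all `m` and `b` is bounded above then `|b 1| ≤ 1`: otherwise
`|b 1| ^ 2ᵏ ≤ b (2ᵏ)` would be unbounded. [folklore] -/
theorem abs_le_one_of_sq_le_double (b : ℕ → ℝ) (K : ℝ) (hCS : ∀ m, b m ^ 2 ≤ b (2 * m))
    (hK : ∀ m, b m ≤ K) : |b 1| ≤ 1 := by
  have claim : ∀ k : ℕ, |b 1| ^ 2 ^ (k + 1) ≤ b (2 ^ (k + 1)) := by
    intro k
    induction k with
    | zero => simpa only [zero_add, pow_one, sq_abs, mul_one] using hCS 1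
    | succ k ih =>
      calc |b 1| ^ 2 ^ (k + 1 + 1) = (|b 1| ^ 2 ^ (k + 1)) ^ 2 := by
            rw [pow_succ (2 : ℕ) (k + 1), pow_mul]
        _ ≤ b (2 ^ (k + 1)) ^ 2 := pow_le_pow_left₀ (pow_nonneg (abs_nonneg _) _) ih 2
        _ ≤ b (2 * 2 ^ (k + 1)) := hCS _
        _ = b (2 ^ (k + 1 + 1)) := by rw [pow_succ' (2 : ℕ) (k + 1)]
  by_contra hlt
  have hx1 : 1 < |b 1| := lt_of_not_ge hlt
  obtain ⟨n, hn⟩ := pow_unbounded_of_one_lt K hx1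
  have hmono : |b 1| ^ n ≤ |b 1| ^ 2 ^ (n + 1) :=
    pow_le_pow_right₀ hx1.le ((Nat.le_succ n).trans Nat.lt_two_pow_self.le)
  exact absurd ((hn.trans_le hmono).trans_le ((claim n).trans (hK _))) (lt_irrefl _)

/-- If `0 ≤ b 0`, `b m ^ 2 ≤ b 0 * b (2 m)` for all `m` and `b` is bounded then `|b 1| ≤ b 0`
(normalise by `b 0` when it is positive; when `b 0 = 0` the case `m = 1` gives `b 1 = 0`).
[folklore] -/
theorem abs_le_of_sq_le_mul_double (b : ℕ → ℝ) (K : ℝ) (h0 : 0 ≤ b 0)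
    (hCS : ∀ m, b m ^ 2 ≤ b 0 * b (2 * m)) (hK : ∀ m, |b m| ≤ K) : |b 1| ≤ b 0 := by
  rcases h0.eq_or_lt with h00 | h0pos
  · have h1 : b 1 ^ 2 ≤ 0 := by
      have h := hCS 1
      rw [← h00, zero_mul] at h
      exact h
    have hb1 : b 1 = 0 := (pow_eq_zero_iff two_ne_zero).mp (le_antisymm h1 (sq_nonneg _))
    rw [hb1, abs_zero]
    exact h0
  · have key := abs_le_one_of_sq_le_double (fun m => b m / b 0) (K / b 0) ?_ ?_
    · rwa [abs_div, abs_of_pos h0pos, div_le_one h0pos] at key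
    · intro m
      show (b m / b 0) ^ 2 ≤ b (2 * m) / b 0
      rw [div_pow, sq (b 0), ← div_div, div_le_div_iff_of_pos_right h0pos, div_le_iff₀ h0pos,
        mul_comm]
      exact hCS m
    · intro m
      exact div_le_div_of_nonneg_right ((le_abs_self _).trans (hK m)) h0

end HankelContraction

open HankelContraction in
/-- **Bounded positive semidefinite Hankel sequences have a contracting shift.** If `a : ℕ → ℝ` is
bounded and all its Hankel forms `c ↦ ∑ᵢ ∑ⱼ cᵢ cⱼ a (i + j)` are positive semidefinite, then
`|∑ᵢ ∑ⱼ cᵢ cⱼ a (i + j + 1)| ≤ ∑ᵢ ∑ⱼ cᵢ cⱼ a (i + j)` for every finite index set `s` and all real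
coefficients `c` (Cauchy–Schwarz iteration `|b₁| ^ 2ᵏ ≤ b₀ ^ (2ᵏ - 1) b_{2ᵏ}` and boundedness of
`bₘ = ∑ᵢ ∑ⱼ cᵢ cⱼ a (i + j + m)`).
[cite: BergChristensenRessel1984, Ch. 4, Prop. 4.9 (bounded positive definite sequences); Ch. 6, §2] -/
theorem hankel_shift_abs_le (a : ℕ → ℝ) (hbdd : ∃ C : ℝ, ∀ n, |a n| ≤ C)
    (hP0 : ∀ (s : Finset ℕ) (c : ℕ → ℝ), 0 ≤ ∑ i ∈ s, ∑ j ∈ s, c i * c j * a (i + j)) :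
    ∀ (s : Finset ℕ) (c : ℕ → ℝ),
      |∑ i ∈ s, ∑ j ∈ s, c i * c j * a (i + j + 1)| ≤ ∑ i ∈ s, ∑ j ∈ s, c i * c j * a (i + j) := by
  intro s c
  obtain ⟨C, hC⟩ := hbdd
  have key := abs_le_of_sq_le_mul_double (fun m => ∑ i ∈ s, ∑ j ∈ s, c i * c j * a (i + j + m))
    (C * (∑ i ∈ s, |c i|) ^ 2) (by simpa only [add_zero] using hP0 s c)
    (fun m => by simpa only [add_zero] using shift_sq_le a hP0 s c m)
    (fun m => abs_sum_sum_le a C hC s c m)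
  simpa only [add_zero] using key

end Literature.MeasureTheory.Integral

end
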